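import Literature.ComputerArithmetic.JeannerodRump2018.OptimalBound

/-!
HONEST FRAMING: certified error envelopes and provably optimal rounding/accumulation schemes for
low-precision formats under stated cost models; every table by two implementations; no hardware
or vendor claims.

# The tree polynomial law for floating-point summation trees (opt, generation 4)

For a summation tree `t` define the *tree polynomial* `M_t(u)` by `M(leaf) = 1`,
`M(node l r) = max (M l) (M r) + u * min (M l) (M r)`.

* **Theorem U** (`exact_le_treeM_mul_eval`, `exact_le_treeM_mul_eval_roundNearest`): for
  nonnegative summands and ANY round-to-nearest `fl` into `F(p, emin)` (JeannerodRump2018 model,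
  any tie rule, gradual underflow, no overflow), every tree satisfies
  `exact t ≤ M_t(u) · eval fl t`, i.e. the relative UNDER-estimation is at most `1 - 1/M_t(u)`.
  (Sharpness under ties-to-even is a paper witness + certified tables, not formalised here.)
* **Theorem P** (file `OptTreePairwise.lean`: `optB_le_treeM`, `treeM_pw`): with `B_n(u)` defined by the pairwise recursion
  `B_0 = 0, B_1 = 1, B_n = B_⌈n/2⌉ + u·B_⌊n/2⌋` (equivalently `Σ_{j<n} u^{popcount j}`), every tree
  with `n` leaves has `B_n(u) ≤ M_t(u)` for `0 ≤ u ≤ 1`, with equality for the pairwise (halving)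
  tree.  Hence pairwise summation minimises the Theorem-U constant over ALL summation trees.

New results of this cell (no literature fact is vendored; the only imported facts are the
elementary consequences of round-to-nearest proved in `JeannerodRump2018.OptimalBound`).
-/

namespace Summit.Ventures.CertifiedArithmetic.LowPrec.Opt

open Literature.ComputerArithmetic.JeannerodRump2018
open Literature.ComputerArithmetic.JeannerodRump2018.SumTree

/-! ## The tree polynomial -/

/-- Tree polynomial `M_t(u)`: `1` at a leaf, `max + u·min` of the children at a node. -/
def treeM (u : ℚ) : SumTree → ℚ
  | .leaf _ => 1
  | .node l r => max (treeM u l) (treeM u r) + u * min (treeM u l) (treeM u r)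

/-- `M(leaf) = 1`. -/
@[simp] theorem treeM_leaf (u x : ℚ) : treeM u (.leaf x) = 1 := rfl

/-- `M(node l r) = max + u·min` of the children. -/
@[simp] theorem treeM_node (u : ℚ) (l r : SumTree) :
    treeM u (.node l r) = max (treeM u l) (treeM u r) + u * min (treeM u l) (treeM u r) := rfl

/-- `1 ≤ M_t(u)` for `u ≥ 0`. -/
theorem one_le_treeM {u : ℚ} (hu : 0 ≤ u) : ∀ t : SumTree, 1 ≤ treeM u t
  | .leaf _ => by simp
  | .node l r => by
      have hl := one_le_treeM hu l
      have hr := one_le_treeM hu r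
      rw [treeM_node]
      have h1 : 1 ≤ max (treeM u l) (treeM u r) := le_trans hl (le_max_left _ _)
      have h2 : 0 ≤ min (treeM u l) (treeM u r) := le_min (by linarith) (by linarith)
      nlinarith [mul_nonneg hu h2]

/-- `x + u·y ≤ max x y + u·min x y` for `u ≤ 1`: the max-orientation dominates any orientation. -/
theorem add_mul_le_max_add_mul_min {u : ℚ} (hu1 : u ≤ 1) (x y : ℚ) :
    x + u * y ≤ max x y + u * min x y := by
  rcases le_total y x with h | h
  · rw [max_eq_left h, min_eq_right h]
  · rw [max_eq_right h, min_eq_left h]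
    nlinarith [mul_nonneg (sub_nonneg.2 hu1) (sub_nonneg.2 h)]

/-! ## Theorem U: the node step and the induction -/

/-- Node step, oriented form (`Mb ≤ Ma`). -/
theorem node_step_oriented {u Ma Mb A B R ea eb : ℚ} (hu0 : 0 ≤ u)
    (hMb : 1 ≤ Mb) (hba : Mb ≤ Ma) (_hA : 0 ≤ A) (_hB : 0 ≤ B)
    (hea : ea ≤ Ma * A) (heb : eb ≤ Mb * B)
    (hRA : A ≤ R) (hR2 : A + B ≤ (1 + u) * R) :
    ea + eb ≤ (Ma + u * Mb) * R := by
  have hMa0 : 0 ≤ Ma := by linarith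
  have hMb0 : 0 ≤ Mb := by linarith
  have hcoef : 0 ≤ Ma + u * Mb := by nlinarith [mul_nonneg hu0 hMb0]
  rcases le_total B (u * A) with hcase | hcase
  · -- light operand below u·A: it may be absorbed entirely
    calc ea + eb ≤ Ma * A + Mb * B := add_le_add hea heb
      _ ≤ Ma * A + Mb * (u * A) := by nlinarith [mul_le_mul_of_nonneg_left hcase hMb0]
      _ = (Ma + u * Mb) * A := by ring
      _ ≤ (Ma + u * Mb) * R := mul_le_mul_of_nonneg_left hRA hcoef
  · -- u·A ≤ B: use the relative bound A + B ≤ (1+u)·R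
    have key : (1 + u) * (Ma * A + Mb * B) ≤ (A + B) * (Ma + u * Mb) := by
      nlinarith [mul_nonneg (sub_nonneg.2 hcase) (sub_nonneg.2 hba)]
    have h2 : (A + B) * (Ma + u * Mb) ≤ (1 + u) * R * (Ma + u * Mb) :=
      mul_le_mul_of_nonneg_right hR2 hcoef
    have h1u : 0 < 1 + u := by linarith
    have h3 : (1 + u) * (ea + eb) ≤ (1 + u) * ((Ma + u * Mb) * R) := by
      calc (1 + u) * (ea + eb) ≤ (1 + u) * (Ma * A + Mb * B) :=
            mul_le_mul_of_nonneg_left (add_le_add hea heb) h1u.le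
        _ ≤ (A + B) * (Ma + u * Mb) := key
        _ ≤ (1 + u) * R * (Ma + u * Mb) := h2
        _ = (1 + u) * ((Ma + u * Mb) * R) := by ring
    exact le_of_mul_le_mul_left h3 h1u

/-- Node step, symmetric form. -/
theorem node_step {u Ma Mb A B R ea eb : ℚ} (hu0 : 0 ≤ u)
    (hMa : 1 ≤ Ma) (hMb : 1 ≤ Mb) (hA : 0 ≤ A) (hB : 0 ≤ B)
    (hea : ea ≤ Ma * A) (heb : eb ≤ Mb * B)
    (hR1 : max A B ≤ R) (hR2 : A + B ≤ (1 + u) * R) :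
    ea + eb ≤ (max Ma Mb + u * min Ma Mb) * R := by
  have hRA : A ≤ R := le_trans (le_max_left _ _) hR1
  have hRB : B ≤ R := le_trans (le_max_right _ _) hR1
  rcases le_total Mb Ma with h | h
  · rw [max_eq_left h, min_eq_right h]
    exact node_step_oriented hu0 hMb h hA hB hea heb hRA hR2
  · rw [max_eq_right h, min_eq_left h, add_comm ea eb]
    exact node_step_oriented hu0 hMa h hB hA heb hea hRB (by linarith)

/-- **Theorem U (abstract).**  `P` = "is a representable value"; `fl` maps into `P`,
never rounds a nonnegative sum of representables below either operand (h1), and has relative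
error `≤ u/(1+u)` in the form `a + b ≤ (1+u)·fl(a+b)` (h2).  Then for nonnegative representable
summands `exact t ≤ M_t(u) · eval fl t`. -/
theorem exact_le_treeM_mul_eval {u : ℚ} (hu0 : 0 ≤ u) (P : ℚ → Prop) (fl : ℚ → ℚ)
    (hP : ∀ t, P (fl t))
    (h1 : ∀ a b, P a → P b → 0 ≤ a → 0 ≤ b → max a b ≤ fl (a + b))
    (h2 : ∀ a b, P a → P b → 0 ≤ a → 0 ≤ b → a + b ≤ (1 + u) * fl (a + b)) :
    ∀ t : SumTree, (∀ x ∈ leaves t, P x ∧ 0 ≤ x) →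
      exact t ≤ treeM u t * eval fl t ∧ P (eval fl t) ∧ 0 ≤ eval fl t
  | .leaf x, hl => by
      have hx := hl x (by simp [leaves])
      simp only [exact, eval, treeM_leaf, one_mul]
      exact ⟨le_rfl, hx.1, hx.2⟩
  | .node l r, hl => by
      have hll : ∀ x ∈ leaves l, P x ∧ 0 ≤ x := fun x hx => hl x (by simp [leaves, hx])
      have hlr : ∀ x ∈ leaves r, P x ∧ 0 ≤ x := fun x hx => hl x (by simp [leaves, hx])
      obtain ⟨ihl, Pl, Al⟩ := exact_le_treeM_mul_eval hu0 P fl hP h1 h2 l hll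
      obtain ⟨ihr, Pr, Br⟩ := exact_le_treeM_mul_eval hu0 P fl hP h1 h2 r hlr
      simp only [exact, eval, treeM_node]
      have hR1 := h1 _ _ Pl Pr Al Br
      have hR2 := h2 _ _ Pl Pr Al Br
      refine ⟨node_step hu0 (one_le_treeM hu0 l) (one_le_treeM hu0 r) Al Br ihl ihr hR1 hR2,
        hP _, le_trans Al (le_trans (le_max_left _ _) hR1)⟩

/-- Corollary form of Theorem U: relative under-estimation `≤ 1 - 1/M_t(u)`. -/
theorem exact_sub_eval_le {u : ℚ} (hu0 : 0 ≤ u) (P : ℚ → Prop) (fl : ℚ → ℚ)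
    (hP : ∀ t, P (fl t))
    (h1 : ∀ a b, P a → P b → 0 ≤ a → 0 ≤ b → max a b ≤ fl (a + b))
    (h2 : ∀ a b, P a → P b → 0 ≤ a → 0 ≤ b → a + b ≤ (1 + u) * fl (a + b))
    (t : SumTree) (hl : ∀ x ∈ leaves t, P x ∧ 0 ≤ x) :
    exact t - eval fl t ≤ (1 - 1 / treeM u t) * exact t := by
  obtain ⟨h, -, hev⟩ := exact_le_treeM_mul_eval hu0 P fl hP h1 h2 t hl
  have hM : 1 ≤ treeM u t := one_le_treeM hu0 t
  have hM0 : 0 < treeM u t := by linarith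
  rw [sub_mul, one_mul, div_mul_eq_mul_div, one_mul]
  have : exact t / treeM u t ≤ eval fl t := by
    rw [div_le_iff₀ hM0]; linarith [mul_comm (treeM u t) (eval fl t)]
  linarith

/-! ### Instantiation: round-to-nearest into `F(p, emin)` (any tie rule) -/

/-- `0 ≤ u`. -/
theorem unitRoundoff_nonneg (p : ℕ) : 0 ≤ unitRoundoff p := by
  unfold unitRoundoff; positivity

/-- `u ≤ 1`. -/
theorem unitRoundoff_le_one (p : ℕ) : unitRoundoff p ≤ 1 := by
  unfold unitRoundoff
  rw [div_le_one (by positivity)]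
  exact one_le_pow₀ (by norm_num)

/-- (h1) for round-to-nearest: `fl(a+b) ≥ max a b` for nonnegative floats `a, b`. -/
theorem max_le_fl_add {p : ℕ} {emin : ℤ} {fl : ℚ → ℚ} (hfl : IsRoundNearest p emin fl)
    {a b : ℚ} (ha : IsFloat p emin a) (hb : IsFloat p emin b) (ha0 : 0 ≤ a) (hb0 : 0 ≤ b) :
    max a b ≤ fl (a + b) := by
  have h1 := abs_sub_fl_le hfl (a + b) ha
  have h2 := abs_sub_fl_le hfl (a + b) hb
  rw [show a + b - a = b by ring, abs_of_nonneg hb0] at h1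
  rw [show a + b - b = a by ring, abs_of_nonneg ha0] at h2
  have h1' := (abs_le.mp h1).2
  have h2' := (abs_le.mp h2).2
  exact max_le (by linarith) (by linarith)

/-- (h2) for round-to-nearest: `a + b ≤ (1+u)·fl(a+b)` for nonnegative floats `a, b`
(exact in the gradual-underflow range, `u/(1+u)`-accurate in the normal range). -/
theorem add_le_one_add_u_mul_fl {p : ℕ} {emin : ℤ} {fl : ℚ → ℚ} (hp : 1 ≤ p)
    (hfl : IsRoundNearest p emin fl) {a b : ℚ} (ha : IsFloat p emin a) (hb : IsFloat p emin b)
    (ha0 : 0 ≤ a) (hb0 : 0 ≤ b) :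
    a + b ≤ (1 + unitRoundoff p) * fl (a + b) := by
  have hu0 := unitRoundoff_nonneg p
  by_cases hsmall : |a + b| < (2 : ℚ) ^ (emin + p)
  · have hF := isFloat_add_of_small ha hb hsmall
    rw [fl_eq_self hfl hF]
    nlinarith [mul_nonneg hu0 (add_nonneg ha0 hb0)]
  · rw [not_lt] at hsmall
    rw [abs_of_nonneg (add_nonneg ha0 hb0)] at hsmall
    have hs := abs_sub_fl_le_sharp_pos hp hfl hsmall
    have key : a + b - fl (a + b) ≤ unitRoundoff p / (1 + unitRoundoff p) * (a + b) :=
      le_trans (le_abs_self _) hs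
    have h1u : (0 : ℚ) < 1 + unitRoundoff p := by linarith
    have hw : (1 + unitRoundoff p) * (unitRoundoff p / (1 + unitRoundoff p)) = unitRoundoff p := by
      field_simp
    have := mul_le_mul_of_nonneg_left key h1u.le
    rw [← mul_assoc, hw] at this
    nlinarith [this]

/-- **Theorem U for round-to-nearest into `F(p, emin)`** (any tie-breaking rule, gradual
underflow, no overflow): for nonnegative floating-point summands and every summation tree,
`exact t ≤ M_t(u) · eval fl t` with `u = 2^-p`. -/
theorem exact_le_treeM_mul_eval_roundNearest {p : ℕ} {emin : ℤ} {fl : ℚ → ℚ} (hp : 1 ≤ p)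
    (hfl : IsRoundNearest p emin fl) (t : SumTree)
    (ht : ∀ x ∈ leaves t, IsFloat p emin x ∧ 0 ≤ x) :
    exact t ≤ treeM (unitRoundoff p) t * eval fl t :=
  (exact_le_treeM_mul_eval (unitRoundoff_nonneg p) (IsFloat p emin) fl (fun s => (hfl s).1)
    (fun _ _ ha hb ha0 hb0 => max_le_fl_add hfl ha hb ha0 hb0)
    (fun _ _ ha hb ha0 hb0 => add_le_one_add_u_mul_fl hp hfl ha hb ha0 hb0) t ht).1

/-- Relative under-estimation form: `exact - computed ≤ (1 - 1/M_t(u)) · exact`. -/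
theorem exact_sub_eval_le_roundNearest {p : ℕ} {emin : ℤ} {fl : ℚ → ℚ} (hp : 1 ≤ p)
    (hfl : IsRoundNearest p emin fl) (t : SumTree)
    (ht : ∀ x ∈ leaves t, IsFloat p emin x ∧ 0 ≤ x) :
    exact t - eval fl t ≤ (1 - 1 / treeM (unitRoundoff p) t) * exact t :=
  exact_sub_eval_le (unitRoundoff_nonneg p) (IsFloat p emin) fl (fun s => (hfl s).1)
    (fun _ _ ha hb ha0 hb0 => max_le_fl_add hfl ha hb ha0 hb0)
    (fun _ _ ha hb ha0 hb0 => add_le_one_add_u_mul_fl hp hfl ha hb ha0 hb0) t ht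

/-! ## Statement-style R4 proposition (same shape as `LowPrec/OptTreeR4.lean`) -/

/-- R4 (Opt, CM-T(F, ≥ 0) Theorem U): for round-to-nearest into `F(p, emin)` with ANY tie rule, nonnegative
floating-point summands and every summation tree, the relative under-estimation is at most `1 - 1/M_t(2^-p)`. -/
def R4_TreePolyUnderestimation : Prop :=
  ∀ (p : ℕ) (emin : ℤ) (fl : ℚ → ℚ), 1 ≤ p → IsRoundNearest p emin fl →
    ∀ t : SumTree, (∀ x ∈ leaves t, IsFloat p emin x ∧ 0 ≤ x) →
      exact t - eval fl t ≤ (1 - 1 / treeM (unitRoundoff p) t) * exact t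

/-- Discharge of `R4_TreePolyUnderestimation` by `exact_sub_eval_le_roundNearest`. -/
theorem R4_TreePolyUnderestimation_holds : R4_TreePolyUnderestimation :=
  fun _ _ _ hp hfl t ht => exact_sub_eval_le_roundNearest hp hfl t ht

end Summit.Ventures.CertifiedArithmetic.LowPrec.Opt
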